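import Literature.Barriers.RiemannHypothesis.MollifierLimitationsPropB
import Literature.NumberTheory.LFunctions.BCHZetaSqDecomposition
import Literature.NumberTheory.LFunctions.BCHDiagonalMeanSquare
import Literature.NumberTheory.LFunctions.BCHCrossTermBlocks
import Literature.NumberTheory.LFunctions.DirichletMVTSharp
import Mathlib.Analysis.SpecialFunctions.Pow.Asymptotics
import Mathlib.Analysis.Complex.ExponentialBounds
import HarnessLib

/-!
# Proof of the Balasubramanian–Conrey–Heath-Brown mean square (`θ < ½`)

Topic `Literature/Barriers/RiemannHypothesis`. Everything in this file is PROVED: it discharges the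
named fact `Literature.Barriers.RiemannHypothesis.BalasubramanianConreyHeathBrown1985_meanSquare`
(`MollifierLimitationsPropB.lean`) as `BalasubramanianConreyHeathBrown1985_meanSquare_holds`.

The proof is the Hardy–Littlewood–Titchmarsh–Levinson evaluation with activated lengths
(Titchmarsh §§7.4, 9.20–9.23; Levinson 1974 §§3–6), assembled from the `BCH*` files of
`Literature/NumberTheory/LFunctions/`:

1. `|ζ(½+it)|² |A|² = 2|S_t A|² + Θ²S_t²|A|² + conj + O(t^{-1/4}(…))` with `S_t = Σ_{n ≤ √(t/2π)} n^{-½-it}`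
   (`BCH.norm_integral_zetaSq_mul_sub_le`);
2. the diagonal half `∫|S_t A|²` (`BCH.norm_meanSquare_sub_diagMain_le`);
3. the cross term on short blocks (`BCH.norm_crossTerm_sub_le`);
4. the kernel identity `2·diagMainCoeff + T|log(h/k)| = T(log(T(h,k)²/(2πhk)) + 2log 2 + 2γ − 1)`;
5. the choice `N = ⌊T^θ⌋`, `J = ⌊T^κ⌋ + 1`, `κ = (½−θ)/2`, `δ = (½−θ)/(8θ)`, `η = T^{-1/4}` and the
   limit `T → ∞`.

## References

* [BalasubramanianConreyHeathBrown1985] R. Balasubramanian, J. B. Conrey, D. R. Heath-Brown,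
  J. reine angew. Math. 357 (1985), 161–181, Theorem 1.
* [BettinChandeeRadziwill2017] S. Bettin, V. Chandee, M. Radziwiłł, J. reine angew. Math. 729 (2017),
  (1.2) (the statement with `θ < ½` attributed to [BCH85]).
* [Titchmarsh1986] §§7.4, 9.20–9.24; [Levinson1974] §§3–6.
-/

noncomputable section

open Finset Real Complex MeasureTheory intervalIntegral Filter Asymptotics
open scoped ComplexConjugate Topology

namespace Literature.Barriers.RiemannHypothesis

open Literature.NumberTheory.LFunctions Literature.NumberTheory.LFunctions.BCH
open Literature.NumberTheory.LFunctions.TwistedMoment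

/-! ### Bridges between the spellings -/

/-- `M(½+it) = A(t)`: the Barriers-file mollifier is `BCH.mollPoly`. [folklore] -/
theorem dirichletMollifier_half_eq (a : ℕ → ℂ) (N : ℕ) (t : ℝ) :
    dirichletMollifier a N (1 / 2 + t * I) = mollPoly a N t := by
  rw [dirichletMollifier, mollPoly_def]
  refine Finset.sum_congr rfl fun n _ => ?_
  congr 2
  push_cast
  ring

/-- `A(t) = Σ (a_n n^{-1/2}) n^{-it}` in the spelling of `DirichletMVT`. [folklore] -/
theorem mollPoly_eq_dirichlet (a : ℕ → ℂ) (N : ℕ) (t : ℝ) :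
    mollPoly a N t = ∑ n ∈ Finset.Icc 1 N,
      (a n * ((((n : ℝ) ^ (-(1 / 2 : ℝ))) : ℝ) : ℂ)) * (n : ℂ) ^ (-((t : ℂ) * I)) := by
  rw [mollPoly_eq_sum_exp]
  refine Finset.sum_congr rfl fun n hn => ?_
  have hn0 : n ≠ 0 := by have := (Finset.mem_Icc.1 hn).1; omega
  rw [natCast_cpow_neg_mul_I hn0]
  have e : cexp (-(I * t * Real.log n)) = Complex.exp (((-(t * Real.log n)) : ℝ) * I) := by
    congr 1; push_cast; ring
  rw [e]; ring

/-- **Mean value of `|A|²` on `[T, 2T]`**: `∫_T^{2T} |A(t)|² dt ≤ B²((5T/2 + 20)(1 + log N) + 65N)` for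
`|a_n| ≤ B`, `T > 0`. [cite: Titchmarsh1986, §7.2] -/
theorem integral_normSq_mollPoly_le (a : ℕ → ℂ) (N : ℕ) {T B : ℝ} (hT : 0 < T)
    (hB : ∀ h ∈ Finset.Icc 1 N, ‖a h‖ ≤ B) :
    ∫ t in T..(2 * T), ‖mollPoly a N t‖ ^ 2 ≤ B ^ 2 * ((5 * (T / 2) + 20) * (1 + Real.log N) + 65 * N) := by
  rcases Nat.eq_zero_or_pos N with rfl | hN
  · simp [mollPoly_def]
    positivity
  have hB0 : 0 ≤ B := le_trans (norm_nonneg _) (hB 1 (Finset.mem_Icc.2 ⟨le_rfl, hN⟩))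
  set b : ℕ → ℂ := fun n => a n * ((((n : ℝ) ^ (-(1 / 2 : ℝ))) : ℝ) : ℂ) with hb
  have h := DirichletMVT.meanSquare_shift_le b N (W := T / 2) (by positivity) (3 * T / 2)
  rw [show 3 * T / 2 - T / 2 = T by ring, show 3 * T / 2 + T / 2 = 2 * T by ring] at h
  have hint : (∫ t in T..(2 * T), ‖mollPoly a N t‖ ^ 2) =
      ∫ t in T..(2 * T), ‖∑ n ∈ Finset.Icc 1 N, b n * (n : ℂ) ^ (-((t : ℂ) * I))‖ ^ 2 := by
    refine intervalIntegral.integral_congr fun t _ => ?_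
    simp only [hb]
    rw [mollPoly_eq_dirichlet]
  rw [hint]
  refine h.trans ?_
  -- `‖b_n‖² = ‖a_n‖²/n ≤ B²/n`
  have hbn : ∀ n ∈ Finset.Icc 1 N, ‖b n‖ ^ 2 ≤ B ^ 2 * (1 / (n : ℝ)) := by
    intro n hn
    have hn0 : (0 : ℝ) < n := by exact_mod_cast (Finset.mem_Icc.1 hn).1
    simp only [hb, norm_mul, Complex.norm_real, Real.norm_of_nonneg (Real.rpow_nonneg hn0.le _)]
    rw [mul_pow, show ((n : ℝ) ^ (-(1 / 2 : ℝ))) ^ 2 = 1 / n by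
      rw [← Real.rpow_natCast, ← Real.rpow_mul hn0.le,
        show (-(1 / 2 : ℝ)) * ((2 : ℕ) : ℝ) = -1 by norm_num, Real.rpow_neg_one, one_div]]
    exact mul_le_mul_of_nonneg_right (pow_le_pow_left₀ (norm_nonneg _) (hB n hn) 2) (by positivity)
  calc ∑ n ∈ Finset.Icc 1 N, (5 * (T / 2) + 20 + 65 * n) * ‖b n‖ ^ 2
      ≤ ∑ n ∈ Finset.Icc 1 N, (5 * (T / 2) + 20 + 65 * n) * (B ^ 2 * (1 / (n : ℝ))) :=
        Finset.sum_le_sum fun n hn => mul_le_mul_of_nonneg_left (hbn n hn) (by positivity)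
    _ = B ^ 2 * ((5 * (T / 2) + 20) * ∑ n ∈ Finset.Icc 1 N, 1 / (n : ℝ) + 65 * N) := by
        have e : ∀ n ∈ Finset.Icc 1 N, (5 * (T / 2) + 20 + 65 * n) * (B ^ 2 * (1 / (n : ℝ))) =
            B ^ 2 * (5 * (T / 2) + 20) * (1 / (n : ℝ)) + B ^ 2 * 65 := by
          intro n hn
          have hn0 : (n : ℝ) ≠ 0 := by exact_mod_cast (show n ≠ 0 by have := (Finset.mem_Icc.1 hn).1; omega)
          field_simp
        rw [Finset.sum_congr rfl e, Finset.sum_add_distrib, ← Finset.mul_sum, Finset.sum_const, Nat.card_Icc,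
          Nat.add_sub_cancel, nsmul_eq_mul]
        ring
    _ ≤ B ^ 2 * ((5 * (T / 2) + 20) * (1 + Real.log N) + 65 * N) := by
        have := sum_one_div_le_log N
        gcongr

/-! ### The kernel identity -/

/-- **`2·diagMainCoeff(M,T) + T|log(h/k)| = T(log(T(h,k)²/(2πhk)) + 2 log 2 + 2γ − 1)`**, `M = redMax h k`
(with `g = (h,k)`, `h = gh'`, `k = gk'`, `M = max(h',k')`, `m = min(h',k')`: `hk = g²Mm` and
`|log(h/k)| = log(M/m)`). [cite: BalasubramanianConreyHeathBrown1985, Theorem 1] -/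
theorem kernel_identity {h k : ℕ} (hh : 0 < h) (hk : 0 < k) {T : ℝ} (hT : 0 < T) :
    2 * diagMainCoeff ((redMax h k : ℕ) : ℝ) T + T * |Real.log ((h : ℝ) / k)| =
      T * (Real.log (T * (Nat.gcd h k : ℝ) ^ 2 / (2 * π * h * k)) + 2 * Real.log 2 +
        2 * Real.eulerMascheroniConstant - 1) := by
  have hπ := Real.pi_pos
  set g := Nat.gcd h k with hg
  set h' := h / g with hh'
  set k' := k / g with hk'
  have hg0 : 0 < g := Nat.gcd_pos_of_pos_left k hh
  have hh'0 : 0 < h' := Nat.div_pos (Nat.le_of_dvd hh (Nat.gcd_dvd_left h k)) hg0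
  have hk'0 : 0 < k' := Nat.div_pos (Nat.le_of_dvd hk (Nat.gcd_dvd_right h k)) hg0
  have hgR : (0 : ℝ) < g := by exact_mod_cast hg0
  have hh'R : (0 : ℝ) < h' := by exact_mod_cast hh'0
  have hk'R : (0 : ℝ) < k' := by exact_mod_cast hk'0
  have eh : (h : ℝ) = g * h' := by
    rw [hh', hg]; exact_mod_cast (Nat.mul_div_cancel' (Nat.gcd_dvd_left h k)).symm
  have ek : (k : ℝ) = g * k' := by
    rw [hk', hg]; exact_mod_cast (Nat.mul_div_cancel' (Nat.gcd_dvd_right h k)).symm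
  have hratio : (h : ℝ) / k = h' / k' := by rw [eh, ek]; field_simp
  rw [diagMainCoeff_def, redMax_def, ← hg, ← hh', ← hk', hratio, eh, ek]
  -- reduce to `log(T/(2πM²)) + |log(h'/k')| = log(T/(2π h' k'))`
  have key : ∀ {M m : ℝ}, 0 < m → m ≤ M →
      Real.log (T / (2 * π * M ^ 2)) + Real.log (M / m) = Real.log (T * (g : ℝ) ^ 2 / (2 * π * (g * M) * (g * m))) := by
    intro M m hm hmM
    have hM : 0 < M := lt_of_lt_of_le hm hmM
    rw [← Real.log_mul (by positivity) (by positivity)]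
    congr 1
    field_simp
  rcases le_total k' h' with hle | hle
  · -- `M = h'`, `m = k'`
    have hmax : ((max h' k' : ℕ) : ℝ) = h' := by rw [max_eq_left hle]
    have hleR : (k' : ℝ) ≤ h' := by exact_mod_cast hle
    have habs : |Real.log ((h' : ℝ) / k')| = Real.log ((h' : ℝ) / k') :=
      abs_of_nonneg (Real.log_nonneg (by rw [le_div_iff₀ hk'R]; linarith))
    rw [hmax, habs]
    have := key hk'R hleR
    linear_combination T * this
  · -- `M = k'`, `m = h'`
    have hmax : ((max h' k' : ℕ) : ℝ) = k' := by rw [max_eq_right hle]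
    have hleR : (h' : ℝ) ≤ k' := by exact_mod_cast hle
    have habs : |Real.log ((h' : ℝ) / k')| = Real.log ((k' : ℝ) / h') := by
      rw [abs_of_nonpos (Real.log_nonpos (by positivity) (by rw [div_le_one hk'R]; exact hleR)),
        ← Real.log_inv, inv_div]
    rw [hmax, habs]
    have := key hh'R hleR
    rw [show 2 * π * ((g : ℝ) * k') * (g * h') = 2 * π * (g * h') * (g * k') by ring] at this
    linear_combination T * this

/-! ### Explicit error functionals -/

/-- The diagonal error of `BCH.norm_meanSquare_sub_diagMain_le` on `[T, 2T]`. [folklore] -/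
def diagErrBound (T : ℝ) (N : ℕ) (B : ℝ) : ℝ :=
  26 * π * B ^ 2 * ((N : ℝ) * (N + 1) * (1 + Real.log N)) +
    2 * (2 * ((N * ⌊Real.sqrt (2 * T / (2 * π))⌋₊ : ℕ) : ℝ) *
        (1 + Real.log ((N * ⌊Real.sqrt (2 * T / (2 * π))⌋₊ : ℕ) : ℝ))) *
      (B ^ 2 * ((1 + Real.log (⌊Real.sqrt (2 * T / (2 * π))⌋₊ : ℕ)) * (1 + Real.log N) ^ 3))

/-- A bound for the diagonal main term: `Σ_{h,k} |a_h a_k| |diagMainCoeff(M_{hk},T)|/[h,k] ≤ diagMainBound`.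
[folklore] -/
def diagMainBound (T : ℝ) (N : ℕ) (B : ℝ) : ℝ :=
  B ^ 2 * (1 + Real.log N) ^ 3 * (T * (Real.log T + 2 * Real.log N + 3))

/-- The mean-square bound for `∫_T^{2T}|A|²`. [folklore] -/
def amsBound (T : ℝ) (N : ℕ) (B : ℝ) : ℝ :=
  B ^ 2 * ((5 * (T / 2) + 20) * (1 + Real.log N) + 65 * N)

/-- `|diagMainCoeff(M, T)| ≤ T (log T + 2 log N + 3)` for `1 ≤ M ≤ N`, `2π ≤ T`. [folklore] -/
theorem abs_diagMainCoeff_le {M : ℕ} {N : ℕ} (hM : 1 ≤ M) (hMN : M ≤ N) {T : ℝ} (hT : 2 * π ≤ T) :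
    |diagMainCoeff (M : ℝ) T| ≤ T * (Real.log T + 2 * Real.log N + 3) := by
  have hπ := Real.pi_pos
  have hπ3 := Real.pi_gt_three
  have hT1 : 1 ≤ T := by linarith
  have hT0 : 0 < T := by linarith
  have hMR : (1 : ℝ) ≤ M := by exact_mod_cast hM
  have hMNR : (M : ℝ) ≤ N := by exact_mod_cast hMN
  have hlogT : 0 ≤ Real.log T := Real.log_nonneg hT1
  have hlogM : 0 ≤ Real.log (M : ℝ) := Real.log_nonneg hMR
  have hlogMN : Real.log (M : ℝ) ≤ Real.log N := Real.log_le_log (by positivity) hMNR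
  have hγ1 := Real.eulerMascheroniConstant_lt_two_thirds
  have hγ0 := Real.one_half_lt_eulerMascheroniConstant
  have hl2 : Real.log 2 < 1 := by
    have := Real.log_two_lt_d9; linarith
  have hl20 : 0 < Real.log 2 := Real.log_pos (by norm_num)
  have hlog2π : Real.log (2 * π) ≤ 2 := by
    have : (2 : ℝ) * π ≤ Real.exp 2 := by
      have := Real.add_one_le_exp (2 : ℝ)  -- `3 ≤ e²` is too weak; use `e² ≥ 1 + 2 + 2²/2 = 5`? use exp 1 bounds
      have h1 : Real.exp 1 > 2.7 := by have := Real.exp_one_gt_d9; linarith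
      have h2 : Real.exp 2 = Real.exp 1 * Real.exp 1 := by rw [← Real.exp_add]; norm_num
      nlinarith [Real.pi_lt_d2]
    calc Real.log (2 * π) ≤ Real.log (Real.exp 2) := Real.log_le_log (by positivity) this
      _ = 2 := Real.log_exp 2
  -- `|log(T/(2πM²))| ≤ log T + 2 + 2 log N`
  have hlogq : |Real.log (T / (2 * π * (M : ℝ) ^ 2))| ≤ Real.log T + 2 + 2 * Real.log N := by
    rw [Real.log_div hT0.ne' (by positivity), Real.log_mul (by positivity) (by positivity),
      Real.log_pow, Nat.cast_ofNat]
    have h0 : 0 ≤ Real.log (2 * π) := Real.log_nonneg (by linarith)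
    rw [abs_le]; constructor <;> nlinarith
  rw [diagMainCoeff_def, abs_mul, abs_of_pos hT0]
  refine mul_le_mul_of_nonneg_left ?_ hT0.le
  have := abs_add_le (Real.log (T / (2 * π * (M : ℝ) ^ 2)) / 2) (Real.eulerMascheroniConstant + Real.log 2 - 1 / 2)
  rw [show Real.log (T / (2 * π * (M : ℝ) ^ 2)) / 2 + Real.eulerMascheroniConstant + Real.log 2 - 1 / 2 =
    Real.log (T / (2 * π * (M : ℝ) ^ 2)) / 2 + (Real.eulerMascheroniConstant + Real.log 2 - 1 / 2) by ring]
  refine this.trans ?_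
  rw [abs_div, abs_two, abs_of_pos (by linarith : 0 < Real.eulerMascheroniConstant + Real.log 2 - 1 / 2)]
  linarith

/-- `Σ_{h,k ≤ N} 1/[h,k] ≤ (1 + log N)³`. [folklore] -/
theorem sum_inv_lcm_le (N : ℕ) :
    ∑ h ∈ Finset.Icc 1 N, ∑ k ∈ Finset.Icc 1 N, 1 / (Nat.lcm h k : ℝ) ≤ (1 + Real.log N) ^ 3 := by
  refine le_trans (le_of_eq ?_) (sum_gcd_div_le N)
  refine Finset.sum_congr rfl fun h hh => Finset.sum_congr rfl fun k hk => ?_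
  have hh0 : 0 < h := (Finset.mem_Icc.1 hh).1
  have hk0 : 0 < k := (Finset.mem_Icc.1 hk).1
  have e : (h : ℝ) * k = Nat.gcd h k * Nat.lcm h k := by exact_mod_cast (Nat.gcd_mul_lcm h k).symm
  have hl : (0 : ℝ) < Nat.lcm h k := by exact_mod_cast Nat.lcm_pos hh0 hk0
  have hg : (0 : ℝ) < Nat.gcd h k := by exact_mod_cast Nat.gcd_pos_of_pos_left k hh0
  rw [e]; field_simp

/-- **The diagonal main term is `O(B² T log⁴)`**:
`‖Σ_{h,k} a_h ā_k/[h,k] · diagMainCoeff(M_{hk}, T)‖ ≤ diagMainBound T N B`. [folklore] -/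
theorem norm_diagMain_le (a : ℕ → ℂ) {N : ℕ} {T B : ℝ} (hT : 2 * π ≤ T)
    (hB : ∀ h ∈ Finset.Icc 1 N, ‖a h‖ ≤ B) :
    ‖∑ h ∈ Finset.Icc 1 N, ∑ k ∈ Finset.Icc 1 N,
        a h * conj (a k) / (Nat.lcm h k : ℂ) * ((diagMainCoeff ((redMax h k : ℕ) : ℝ) T : ℝ) : ℂ)‖ ≤
      diagMainBound T N B := by
  have hπ3 := Real.pi_gt_three
  rcases Nat.eq_zero_or_pos N with rfl | hN
  · have hT0 : 0 < T := by linarith [Real.pi_pos]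
    have hlogT : 0 ≤ Real.log T := Real.log_nonneg (by linarith)
    simp [diagMainBound]
    positivity
  have hB0 : 0 ≤ B := le_trans (norm_nonneg _) (hB 1 (Finset.mem_Icc.2 ⟨le_rfl, hN⟩))
  have hT0 : 0 < T := by linarith [Real.pi_pos]
  have hlogN : 0 ≤ Real.log (N : ℝ) := Real.log_natCast_nonneg N
  have hlogT : 0 ≤ Real.log T := Real.log_nonneg (by linarith)
  set K := T * (Real.log T + 2 * Real.log N + 3) with hK
  have hK0 : 0 ≤ K := by positivity
  have hpt : ∀ h ∈ Finset.Icc 1 N, ∀ k ∈ Finset.Icc 1 N,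
      ‖a h * conj (a k) / (Nat.lcm h k : ℂ) * ((diagMainCoeff ((redMax h k : ℕ) : ℝ) T : ℝ) : ℂ)‖ ≤
        B ^ 2 * K * (1 / (Nat.lcm h k : ℝ)) := by
    intro h hh k hk
    have hh0 : 0 < h := (Finset.mem_Icc.1 hh).1
    have hk0 : 0 < k := (Finset.mem_Icc.1 hk).1
    have hl : (0 : ℝ) < Nat.lcm h k := by exact_mod_cast Nat.lcm_pos hh0 hk0
    -- `1 ≤ redMax ≤ N`
    have hM1 : 1 ≤ redMax h k := redMax_pos k hh0
    have hMN : redMax h k ≤ N := by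
      rw [redMax_def]
      exact max_le ((Nat.div_le_self _ _).trans (Finset.mem_Icc.1 hh).2)
        ((Nat.div_le_self _ _).trans (Finset.mem_Icc.1 hk).2)
    have hd := abs_diagMainCoeff_le hM1 hMN hT
    rw [norm_mul, norm_div, norm_mul, Complex.norm_conj, Complex.norm_natCast, Complex.norm_real,
      Real.norm_eq_abs]
    have hab : ‖a h‖ * ‖a k‖ ≤ B ^ 2 := by
      rw [sq]; exact mul_le_mul (hB h hh) (hB k hk) (norm_nonneg _) hB0
    calc ‖a h‖ * ‖a k‖ / (Nat.lcm h k : ℝ) * |diagMainCoeff ((redMax h k : ℕ) : ℝ) T|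
        ≤ B ^ 2 / (Nat.lcm h k : ℝ) * K := by gcongr
      _ = B ^ 2 * K * (1 / (Nat.lcm h k : ℝ)) := by ring
  refine (norm_sum_le _ _).trans ((Finset.sum_le_sum fun h hh => (norm_sum_le _ _).trans
    (Finset.sum_le_sum fun k hk => hpt h hh k hk)).trans ?_)
  simp_rw [← Finset.mul_sum]
  rw [diagMainBound, ← hK]
  have := sum_inv_lcm_le N
  calc B ^ 2 * K * ∑ h ∈ Finset.Icc 1 N, ∑ k ∈ Finset.Icc 1 N, 1 / (Nat.lcm h k : ℝ)
      ≤ B ^ 2 * K * (1 + Real.log N) ^ 3 := mul_le_mul_of_nonneg_left this (by positivity)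
    _ = B ^ 2 * (1 + Real.log N) ^ 3 * K := by ring

/-! ### The mean square at height `T` with explicit errors -/

/-- Real part of one diagonal term. [folklore] -/
theorem re_div_natCast_mul_ofReal (z : ℂ) {l : ℕ} (hl : 0 < l) (r : ℝ) :
    (z / (l : ℂ) * (r : ℂ)).re = z.re * (r / l) := by
  have hlC : (l : ℂ) ≠ 0 := by exact_mod_cast hl.ne'
  have e : z / (l : ℂ) * (r : ℂ) = z * ((r / l : ℝ) : ℂ) := by
    push_cast; field_simp
  rw [e, Complex.re_mul_ofReal]

set_option maxHeartbeats 1600000 in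
/-- **The BCH mean square at height `T`, explicit form.** For `2π ≤ T`, `t₁ ≤ T` (where
`|e_t| ≤ C₁t^{-1/4}` for `t ≥ t₁`), `1 ≤ N`, `2N ≤ √(T/2π)`, `J ≥ 1`, `η > 0`, `|a_h| ≤ B`:
`|∫_T^{2T} |ζ(½+it)|²|A(t)|² dt − T·𝒬_T(a)| ≤ 2·diagErr + 2J·blockErr + 4η(diagMain + diagErr) + (1+1/η)C₁²T^{-1/2}·ams`.
[cite: BalasubramanianConreyHeathBrown1985, Theorem 1] -/
theorem abs_meanSquare_sub_quadForm_le (a : ℕ → ℂ) {N J : ℕ} {T B C₁ t₁ η : ℝ}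
    (herr : ∀ t : ℝ, t₁ ≤ t → ‖hardyZErr ⌊Real.sqrt (t / (2 * π))⌋₊ t‖ ≤ C₁ * t ^ (-(1 / 4 : ℝ)))
    (ht₁ : 0 < t₁) (ht₁T : t₁ ≤ T) (hT2π : 2 * π ≤ T)
    (hN : 2 * (N : ℝ) ≤ Real.sqrt (T / (2 * π))) (hJ : 0 < J) (hη : 0 < η)
    (hB : ∀ h ∈ Finset.Icc 1 N, ‖a h‖ ≤ B) :
    |(∫ t in T..(2 * T), ‖riemannZeta (1 / 2 + t * I)‖ ^ 2 * ‖mollPoly a N t‖ ^ 2) - T * bchQuadForm T N a| ≤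
      2 * diagErrBound T N B + 2 * (J * blockErr T N B J) +
        (4 * η * (diagMainBound T N B + diagErrBound T N B) +
          (1 + 1 / η) * C₁ ^ 2 * T ^ (-(1 / 2 : ℝ)) * amsBound T N B) := by
  have hπ := Real.pi_pos
  have hT0 : 0 < T := lt_of_lt_of_le ht₁ ht₁T
  have hTT : T ≤ 2 * T := by linarith
  -- (1) the decomposition of `|ζ|²|A|²`
  have hF₂ := intervalIntegrable_normSq_actProd a N hT0 hTT
  have hF₃ := intervalIntegrable_crossIntegrand a N hT0 hTT
  have h12 := norm_integral_zetaSq_mul_sub_le herr (continuous_mollPoly a N) ht₁ ht₁T hTT hF₂ hF₃ hη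
  -- names
  set Icx := ∫ t in T..(2 * T), (((‖riemannZeta (1 / 2 + t * I)‖ ^ 2 * ‖mollPoly a N t‖ ^ 2 : ℝ)) : ℂ)
    with hIcx
  set Dcx := ∫ t in T..(2 * T), (((‖actMainSum t * mollPoly a N t‖ ^ 2 : ℝ)) : ℂ) with hDcx
  set Cx := ∫ t in T..(2 * T), thetaMainPhase t ^ 2 * actMainSum t ^ 2 * ((‖mollPoly a N t‖ ^ 2 : ℝ) : ℂ)
    with hCx
  set DM := ∑ h ∈ Finset.Icc 1 N, ∑ k ∈ Finset.Icc 1 N,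
    a h * conj (a k) / (Nat.lcm h k : ℂ) * ((diagMainCoeff ((redMax h k : ℕ) : ℝ) T : ℝ) : ℂ) with hDM
  set Z := pairMainZ a N with hZ
  set D := ∫ t in T..(2 * T), ‖actMainSum t * mollPoly a N t‖ ^ 2 with hD
  set Ire := ∫ t in T..(2 * T), ‖riemannZeta (1 / 2 + t * I)‖ ^ 2 * ‖mollPoly a N t‖ ^ 2 with hIre
  have hIcx_eq : Icx = ((Ire : ℝ) : ℂ) := by rw [hIcx, hIre, ← intervalIntegral.integral_ofReal]
  have hDcx_eq : Dcx = ((D : ℝ) : ℂ) := by rw [hDcx, hD, ← intervalIntegral.integral_ofReal]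
  -- (2) the diagonal half
  have hdiag := norm_meanSquare_sub_diagMain_le a N hT0 hB
  have hDeq : (∫ t in T..(2 * T), ‖(∑ k ∈ Finset.Icc 1 N, a k * (k : ℂ) ^ (-(((1 / 2 : ℝ) : ℂ) + t * I))) *
      (∑ n ∈ Finset.Icc 1 ⌊Real.sqrt (t / (2 * π))⌋₊, (n : ℂ) ^ (-(((1 / 2 : ℝ) : ℂ) + t * I)))‖ ^ 2) = D := by
    rw [hD]
    refine intervalIntegral.integral_congr fun t _ => ?_
    rw [← mollPoly_def, sum_cpow_eq_mainSum, norm_mul, norm_mul, mul_comm]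
    rfl
  rw [hDeq, ← hDcx_eq, ← hDM] at hdiag
  replace hdiag : ‖Dcx - DM‖ ≤ diagErrBound T N B := hdiag
  -- (3) the cross term
  have hcross : ‖Cx - (T : ℂ) * Z‖ ≤ J * blockErr T N B J := norm_crossTerm_sub_le a N hT2π hN hJ hB
  -- (4) combine in `ℂ`
  set Main := 2 * DM + ((T : ℂ) * Z + conj ((T : ℂ) * Z)) with hMain
  have e : Icx - Main = (Icx - 2 * Dcx - Cx - conj Cx) + 2 * (Dcx - DM) + (Cx - (T : ℂ) * Z) +
      conj (Cx - (T : ℂ) * Z) := by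
    rw [hMain, map_sub]; ring
  have hnorm : ‖Icx - Main‖ ≤ (4 * η * D + (1 + 1 / η) * C₁ ^ 2 * T ^ (-(1 / 2 : ℝ)) *
      ∫ t in T..(2 * T), ‖mollPoly a N t‖ ^ 2) + 2 * diagErrBound T N B + 2 * (J * blockErr T N B J) := by
    rw [e]
    have t1 : ‖Icx - 2 * Dcx - Cx - conj Cx‖ ≤ 4 * η * D + (1 + 1 / η) * C₁ ^ 2 * T ^ (-(1 / 2 : ℝ)) *
        ∫ t in T..(2 * T), ‖mollPoly a N t‖ ^ 2 := h12
    have t2 : ‖2 * (Dcx - DM)‖ ≤ 2 * diagErrBound T N B := by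
      rw [norm_mul, Complex.norm_two]; exact mul_le_mul_of_nonneg_left hdiag (by norm_num)
    have t4 : ‖conj (Cx - (T : ℂ) * Z)‖ ≤ J * blockErr T N B J := by rw [Complex.norm_conj]; exact hcross
    calc _ ≤ ‖Icx - 2 * Dcx - Cx - conj Cx‖ + ‖2 * (Dcx - DM)‖ + ‖Cx - (T : ℂ) * Z‖ + ‖conj (Cx - (T : ℂ) * Z)‖ := by
          refine (norm_add_le _ _).trans (add_le_add ((norm_add_le _ _).trans (add_le_add (norm_add_le _ _) le_rfl)) le_rfl)
      _ ≤ _ := by linarith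
  -- (5) real parts: `Re Main = T 𝒬`
  have hre : Main.re = T * bchQuadForm T N a := by
    have hZ2 : ((T : ℂ) * Z + conj ((T : ℂ) * Z)).re = T * (2 * Z.re) := by
      rw [Complex.add_conj]; simp; ring
    have hZre := two_re_pairMain_eq a N
    rw [← pairMainZ_def, ← hZ] at hZre
    have hDMre : DM.re = ∑ h ∈ Finset.Icc 1 N, ∑ k ∈ Finset.Icc 1 N,
        (a h * conj (a k)).re * (diagMainCoeff ((redMax h k : ℕ) : ℝ) T / (Nat.lcm h k : ℝ)) := by
      rw [hDM, Complex.re_sum]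
      refine Finset.sum_congr rfl fun h hh => ?_
      rw [Complex.re_sum]
      refine Finset.sum_congr rfl fun k hk => ?_
      exact re_div_natCast_mul_ofReal _ (Nat.lcm_pos (Finset.mem_Icc.1 hh).1 (Finset.mem_Icc.1 hk).1) _
    rw [hMain, Complex.add_re, hZ2, hZre, Complex.mul_re]
    simp only [Complex.re_ofNat, Complex.im_ofNat, zero_mul, sub_zero]
    rw [hDMre, bchQuadForm, Finset.mul_sum, Finset.mul_sum, Finset.mul_sum, ← Finset.sum_add_distrib]
    refine Finset.sum_congr rfl fun h hh => ?_
    rw [Finset.mul_sum, Finset.mul_sum, Finset.mul_sum, ← Finset.sum_add_distrib]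
    refine Finset.sum_congr rfl fun k hk => ?_
    have hh0 : 0 < h := (Finset.mem_Icc.1 hh).1
    have hk0 : 0 < k := (Finset.mem_Icc.1 hk).1
    have hl : (0 : ℝ) < Nat.lcm h k := by exact_mod_cast Nat.lcm_pos hh0 hk0
    have hker := kernel_identity hh0 hk0 hT0
    calc 2 * ((a h * conj (a k)).re * (diagMainCoeff ((redMax h k : ℕ) : ℝ) T / (Nat.lcm h k : ℝ))) +
          T * ((a h * conj (a k)).re * (|Real.log ((h : ℝ) / k)| / (Nat.lcm h k : ℝ)))
        = (a h * conj (a k)).re / (Nat.lcm h k : ℝ) *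
            (2 * diagMainCoeff ((redMax h k : ℕ) : ℝ) T + T * |Real.log ((h : ℝ) / k)|) := by
          field_simp
      _ = _ := by rw [hker]; ring
  -- (6) `|I − T𝒬| ≤ ‖Icx − Main‖`
  have hmainre : |Ire - T * bchQuadForm T N a| ≤ ‖Icx - Main‖ := by
    have : (Icx - Main).re = Ire - T * bchQuadForm T N a := by
      rw [Complex.sub_re, hIcx_eq, Complex.ofReal_re, hre]
    rw [← this]; exact Complex.abs_re_le_norm _
  -- (7) the two integrals in the error
  have hD0 : 0 ≤ D := intervalIntegral.integral_nonneg hTT fun t _ => by positivity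
  have hDle : D ≤ diagMainBound T N B + diagErrBound T N B := by
    have h1 : ‖Dcx‖ = D := by rw [hDcx_eq, Complex.norm_real, Real.norm_of_nonneg hD0]
    have h2 : ‖Dcx‖ ≤ ‖DM‖ + ‖Dcx - DM‖ := norm_le_norm_add_norm_sub' _ _
    have h3 := norm_diagMain_le a hT2π hB
    rw [← hDM] at h3
    linarith [hdiag]
  have hA := integral_normSq_mollPoly_le a N hT0 hB
  have hcoef : 0 ≤ (1 + 1 / η) * C₁ ^ 2 * T ^ (-(1 / 2 : ℝ)) := by positivity
  calc |Ire - T * bchQuadForm T N a| ≤ ‖Icx - Main‖ := hmainre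
    _ ≤ _ := hnorm
    _ ≤ (4 * η * (diagMainBound T N B + diagErrBound T N B) +
          (1 + 1 / η) * C₁ ^ 2 * T ^ (-(1 / 2 : ℝ)) * amsBound T N B) +
        2 * diagErrBound T N B + 2 * (J * blockErr T N B J) := by
        have : 4 * η * D ≤ 4 * η * (diagMainBound T N B + diagErrBound T N B) :=
          mul_le_mul_of_nonneg_left hDle (by positivity)
        have : (1 + 1 / η) * C₁ ^ 2 * T ^ (-(1 / 2 : ℝ)) * ∫ t in T..(2 * T), ‖mollPoly a N t‖ ^ 2 ≤
            (1 + 1 / η) * C₁ ^ 2 * T ^ (-(1 / 2 : ℝ)) * amsBound T N B := mul_le_mul_of_nonneg_left hA hcoef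
        linarith
    _ = _ := by ring

/-! ### Atom bounds `0 ≤ f(T) ≤ c T^a (1 + log T)^m` for `T ≥ 1` -/

/-- Atom-bound calculus helper (`0 ≤ f ≤ c·T^a·(1+log T)^m` bookkeeping). [folklore] -/
theorem ab_const {c : ℝ} (hc : 0 ≤ c) :
    ∀ T : ℝ, 1 ≤ T → 0 ≤ c ∧ c ≤ c * T ^ (0 : ℝ) * (1 + Real.log T) ^ (0 : ℕ) := by
  intro T hT; simp [hc]

/-- Products of atom bounds (exponents and degrees add). [folklore] -/
theorem ab_mul {f g : ℝ → ℝ} {c a c' a' : ℝ} {m m' : ℕ}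
    (hf : ∀ T : ℝ, 1 ≤ T → 0 ≤ f T ∧ f T ≤ c * T ^ a * (1 + Real.log T) ^ m)
    (hg : ∀ T : ℝ, 1 ≤ T → 0 ≤ g T ∧ g T ≤ c' * T ^ a' * (1 + Real.log T) ^ m') :
    ∀ T : ℝ, 1 ≤ T → 0 ≤ f T * g T ∧ f T * g T ≤ (c * c') * T ^ (a + a') * (1 + Real.log T) ^ (m + m') := by
  intro T hT
  obtain ⟨hf0, hf1⟩ := hf T hT
  obtain ⟨hg0, hg1⟩ := hg T hT
  refine ⟨mul_nonneg hf0 hg0, ?_⟩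
  have hT0 : 0 < T := by linarith
  calc f T * g T ≤ (c * T ^ a * (1 + Real.log T) ^ m) * (c' * T ^ a' * (1 + Real.log T) ^ m') :=
        mul_le_mul hf1 hg1 hg0 (hf0.trans hf1)
    _ = (c * c') * T ^ (a + a') * (1 + Real.log T) ^ (m + m') := by
        rw [Real.rpow_add hT0, pow_add]; ring

/-- Weakening an atom bound (larger constant, exponent, degree). [folklore] -/
theorem ab_mono {f : ℝ → ℝ} {c a : ℝ} {m : ℕ} {c' a' : ℝ} {m' : ℕ}
    (hf : ∀ T : ℝ, 1 ≤ T → 0 ≤ f T ∧ f T ≤ c * T ^ a * (1 + Real.log T) ^ m)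
    (hc : c ≤ c') (ha : a ≤ a') (hm : m ≤ m') :
    ∀ T : ℝ, 1 ≤ T → 0 ≤ f T ∧ f T ≤ c' * T ^ a' * (1 + Real.log T) ^ m' := by
  intro T hT
  obtain ⟨hf0, hf1⟩ := hf T hT
  refine ⟨hf0, hf1.trans ?_⟩
  have hL : 1 ≤ 1 + Real.log T := by linarith [Real.log_nonneg hT]
  have hTa : T ^ a ≤ T ^ a' := Real.rpow_le_rpow_of_exponent_le hT ha
  have hLm : (1 + Real.log T) ^ m ≤ (1 + Real.log T) ^ m' := pow_le_pow_right₀ hL hm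
  have hc0 : 0 ≤ c := by
    -- from `0 ≤ f T ≤ c T^a L^m` with positive `T^a L^m`
    have hpos : 0 < T ^ a * (1 + Real.log T) ^ m := by positivity
    nlinarith [hf0.trans hf1]
  have : 0 ≤ c' := hc0.trans hc
  calc c * T ^ a * (1 + Real.log T) ^ m ≤ c' * T ^ a * (1 + Real.log T) ^ m := by gcongr
    _ ≤ c' * T ^ a' * (1 + Real.log T) ^ m' := by gcongr

/-- Sums of atom bounds with the same exponent and degree. [folklore] -/
theorem ab_add {f g : ℝ → ℝ} {c c' a : ℝ} {m : ℕ}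
    (hf : ∀ T : ℝ, 1 ≤ T → 0 ≤ f T ∧ f T ≤ c * T ^ a * (1 + Real.log T) ^ m)
    (hg : ∀ T : ℝ, 1 ≤ T → 0 ≤ g T ∧ g T ≤ c' * T ^ a * (1 + Real.log T) ^ m) :
    ∀ T : ℝ, 1 ≤ T → 0 ≤ f T + g T ∧ f T + g T ≤ (c + c') * T ^ a * (1 + Real.log T) ^ m := by
  intro T hT
  obtain ⟨hf0, hf1⟩ := hf T hT
  obtain ⟨hg0, hg1⟩ := hg T hT
  exact ⟨add_nonneg hf0 hg0, by linarith⟩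

/-- Transfer of an atom bound to a smaller non-negative function. [folklore] -/
theorem ab_le {f g : ℝ → ℝ} {c a : ℝ} {m : ℕ}
    (hf : ∀ T : ℝ, 1 ≤ T → 0 ≤ f T ∧ f T ≤ c * T ^ a * (1 + Real.log T) ^ m)
    (hgf : ∀ T : ℝ, 1 ≤ T → 0 ≤ g T ∧ g T ≤ f T) :
    ∀ T : ℝ, 1 ≤ T → 0 ≤ g T ∧ g T ≤ c * T ^ a * (1 + Real.log T) ^ m := fun T hT =>
  ⟨(hgf T hT).1, (hgf T hT).2.trans (hf T hT).2⟩

/-- Natural powers of atom bounds. [folklore] -/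
theorem ab_pow {f : ℝ → ℝ} {c a : ℝ} {m : ℕ}
    (hf : ∀ T : ℝ, 1 ≤ T → 0 ≤ f T ∧ f T ≤ c * T ^ a * (1 + Real.log T) ^ m) (n : ℕ) :
    ∀ T : ℝ, 1 ≤ T → 0 ≤ f T ^ n ∧ f T ^ n ≤ c ^ n * T ^ (n * a) * (1 + Real.log T) ^ (n * m) := by
  intro T hT
  obtain ⟨hf0, hf1⟩ := hf T hT
  have hT0 : 0 < T := by linarith
  refine ⟨pow_nonneg hf0 n, ?_⟩
  calc f T ^ n ≤ (c * T ^ a * (1 + Real.log T) ^ m) ^ n := pow_le_pow_left₀ hf0 hf1 n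
    _ = c ^ n * T ^ (n * a) * (1 + Real.log T) ^ (n * m) := by
        rw [mul_pow, mul_pow, ← Real.rpow_natCast (T ^ a) n, ← Real.rpow_mul hT0.le, ← pow_mul, mul_comm a,
          mul_comm m n]

/-! ### Atoms -/

/-- Atom-bound calculus helper (`0 ≤ f ≤ c·T^a·(1+log T)^m` bookkeeping). [folklore] -/
theorem ab_rpow (a : ℝ) : ∀ T : ℝ, 1 ≤ T → 0 ≤ T ^ a ∧ T ^ a ≤ 1 * T ^ a * (1 + Real.log T) ^ (0 : ℕ) := by
  intro T hT; refine ⟨Real.rpow_nonneg (by linarith) a, by simp⟩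

/-- `T` is an atom. [folklore] -/
theorem ab_id : ∀ T : ℝ, 1 ≤ T → 0 ≤ T ∧ T ≤ 1 * T ^ (1 : ℝ) * (1 + Real.log T) ^ (0 : ℕ) := by
  intro T hT; refine ⟨by linarith, by simp⟩

/-- `√T` is an atom. [folklore] -/
theorem ab_sqrt : ∀ T : ℝ, 1 ≤ T → 0 ≤ Real.sqrt T ∧ Real.sqrt T ≤ 1 * T ^ (1 / 2 : ℝ) * (1 + Real.log T) ^ (0 : ℕ) := by
  intro T hT; refine ⟨Real.sqrt_nonneg T, by rw [Real.sqrt_eq_rpow]; simp⟩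

/-- If `0 ≤ g ≤ k T^p` (`k ≥ 1`) and `0 ≤ log g` then `log g ≤ (log k + max(p,1))·(1 + log T)`.
[folklore] -/
theorem ab_log_of_le {g : ℝ → ℝ} {p k : ℝ} (hk : 1 ≤ k)
    (hg : ∀ T : ℝ, 1 ≤ T → 0 ≤ Real.log (g T) ∧ 0 ≤ g T ∧ g T ≤ k * T ^ p) :
    ∀ T : ℝ, 1 ≤ T → 0 ≤ Real.log (g T) ∧
      Real.log (g T) ≤ (Real.log k + max p 1) * T ^ (0 : ℝ) * (1 + Real.log T) ^ (1 : ℕ) := by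
  intro T hT
  obtain ⟨h0, hg0, h1⟩ := hg T hT
  refine ⟨h0, ?_⟩
  simp only [Real.rpow_zero, mul_one, pow_one]
  have hlogT : 0 ≤ Real.log T := Real.log_nonneg hT
  have hlogk : 0 ≤ Real.log k := Real.log_nonneg hk
  have hmax1 : 1 ≤ max p 1 := le_max_right _ _
  rcases eq_or_lt_of_le hg0 with heq | hpos
  · rw [← heq, Real.log_zero]; nlinarith
  · calc Real.log (g T) ≤ Real.log (k * T ^ p) := Real.log_le_log hpos h1
      _ = Real.log k + p * Real.log T := by
          rw [Real.log_mul (by linarith) (by positivity), Real.log_rpow (by linarith)]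
      _ ≤ Real.log k + max p 1 * Real.log T := by
          linarith [mul_le_mul_of_nonneg_right (le_max_left p 1) hlogT]
      _ ≤ (Real.log k + max p 1) * (1 + Real.log T) := by nlinarith

/-- Transfer of an atom bound along a pointwise equality. [folklore] -/
theorem ab_congr {f g : ℝ → ℝ} {c a : ℝ} {m : ℕ}
    (hf : ∀ T : ℝ, 1 ≤ T → 0 ≤ f T ∧ f T ≤ c * T ^ a * (1 + Real.log T) ^ m)
    (hgf : ∀ T : ℝ, 1 ≤ T → g T = f T) :
    ∀ T : ℝ, 1 ≤ T → 0 ≤ g T ∧ g T ≤ c * T ^ a * (1 + Real.log T) ^ m := fun T hT => by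
  rw [hgf T hT]; exact hf T hT

/-- The envelope `T^e (1 + log T)^m` is `o(T)` for `e < 1`. [folklore] -/
theorem isLittleO_rpow_mul_log_pow {e : ℝ} (he : e < 1) (m : ℕ) (K : ℝ) :
    (fun T : ℝ => K * T ^ e * (1 + Real.log T) ^ m) =o[atTop] fun T => T := by
  -- `(1 + log T)^m ≤ (2 log T)^m` for `T ≥ e`, and `(log T)^m = o(T^{1-e})`
  have h1 : (fun T : ℝ => (1 + Real.log T) ^ m) =O[atTop] fun T => Real.log T ^ (m : ℝ) := by
    refine IsBigO.of_bound (2 ^ m) ?_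
    filter_upwards [eventually_ge_atTop (Real.exp 1)] with T hT
    have hlog : 1 ≤ Real.log T := by
      rw [← Real.log_exp 1]; exact Real.log_le_log (Real.exp_pos 1) hT
    rw [Real.norm_of_nonneg (by positivity), Real.norm_of_nonneg (by positivity), Real.rpow_natCast,
      ← mul_pow]
    exact pow_le_pow_left₀ (by positivity) (by linarith) m
  have h2 : (fun T : ℝ => Real.log T ^ (m : ℝ)) =o[atTop] fun T => T ^ (1 - e) :=
    isLittleO_log_rpow_rpow_atTop (m : ℝ) (by linarith)
  have h3 : (fun T : ℝ => (1 + Real.log T) ^ m) =o[atTop] fun T => T ^ (1 - e) := h1.trans_isLittleO h2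
  have h4 : (fun T : ℝ => K * T ^ e) =O[atTop] fun T => K * T ^ e := isBigO_refl _ _
  have h5 := h4.mul_isLittleO h3
  refine (h5.congr_left fun T => by ring).trans_isBigO ?_
  refine IsBigO.of_bound |K| ?_
  filter_upwards [eventually_gt_atTop (0 : ℝ)] with T hT
  rw [Real.norm_of_nonneg (le_of_lt hT), show K * T ^ e * T ^ (1 - e) = K * T by
    rw [mul_assoc, ← Real.rpow_add hT]; norm_num]
  rw [norm_mul, Real.norm_eq_abs, Real.norm_of_nonneg hT.le]

/-! ### Concrete atoms -/

/-- Atom-bound calculus helper (`0 ≤ f ≤ c·T^a·(1+log T)^m` bookkeeping). [folklore] -/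
theorem ab_natFloor_rpow (θ : ℝ) :
    ∀ T : ℝ, 1 ≤ T → 0 ≤ ((⌊T ^ θ⌋₊ : ℕ) : ℝ) ∧ ((⌊T ^ θ⌋₊ : ℕ) : ℝ) ≤ 1 * T ^ θ * (1 + Real.log T) ^ (0 : ℕ) := by
  intro T hT
  refine ⟨Nat.cast_nonneg _, ?_⟩
  simp only [one_mul, pow_zero, mul_one]
  exact Nat.floor_le (Real.rpow_nonneg (by linarith) θ)

/-- `1 ≤ ⌊T^θ⌋` for `T ≥ 1`, `θ ≥ 0`. [folklore] -/
theorem one_le_natFloor_rpow {θ T : ℝ} (hθ : 0 ≤ θ) (hT : 1 ≤ T) : 1 ≤ ⌊T ^ θ⌋₊ :=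
  Nat.le_floor (by rw [Nat.cast_one]; exact Real.one_le_rpow hT hθ)

/-- `log ⌊T^θ⌋ ≪ 1 + log T`. [folklore] -/
theorem ab_log_natFloor_rpow (θ : ℝ) :
    ∀ T : ℝ, 1 ≤ T → 0 ≤ Real.log ((⌊T ^ θ⌋₊ : ℕ) : ℝ) ∧
      Real.log ((⌊T ^ θ⌋₊ : ℕ) : ℝ) ≤ (Real.log 1 + max θ 1) * T ^ (0 : ℝ) * (1 + Real.log T) ^ (1 : ℕ) :=
  ab_log_of_le le_rfl fun T hT => ⟨Real.log_natCast_nonneg _, Nat.cast_nonneg _, by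
    rw [one_mul]; exact Nat.floor_le (Real.rpow_nonneg (by linarith) θ)⟩

/-- `⌊√(2T/2π)⌋ ≤ T^{1/2}`. [folklore] -/
theorem ab_natFloor_sqrt :
    ∀ T : ℝ, 1 ≤ T → 0 ≤ ((⌊Real.sqrt (2 * T / (2 * π))⌋₊ : ℕ) : ℝ) ∧
      ((⌊Real.sqrt (2 * T / (2 * π))⌋₊ : ℕ) : ℝ) ≤ 1 * T ^ (1 / 2 : ℝ) * (1 + Real.log T) ^ (0 : ℕ) := by
  intro T hT
  refine ⟨Nat.cast_nonneg _, ?_⟩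
  simp only [one_mul, pow_zero, mul_one]
  refine (Nat.floor_le (Real.sqrt_nonneg _)).trans ?_
  rw [← Real.sqrt_eq_rpow]
  refine Real.sqrt_le_sqrt ?_
  rw [div_le_iff₀ (by positivity)]; nlinarith [Real.pi_gt_three]

/-- `√(T/π) ≤ T^{1/2}`. [folklore] -/
theorem ab_sqrt_div_pi :
    ∀ T : ℝ, 1 ≤ T → 0 ≤ Real.sqrt (T / π) ∧ Real.sqrt (T / π) ≤ 1 * T ^ (1 / 2 : ℝ) * (1 + Real.log T) ^ (0 : ℕ) := by
  intro T hT
  refine ⟨Real.sqrt_nonneg _, ?_⟩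
  simp only [one_mul, pow_zero, mul_one]
  rw [← Real.sqrt_eq_rpow]
  refine Real.sqrt_le_sqrt ?_
  rw [div_le_iff₀ Real.pi_pos]; nlinarith [Real.pi_gt_three]

/-- `√(2T/2π) ≤ T^{1/2}`. [folklore] -/
theorem ab_sqrt_two_mul_div :
    ∀ T : ℝ, 1 ≤ T → 0 ≤ Real.sqrt (2 * T / (2 * π)) ∧
      Real.sqrt (2 * T / (2 * π)) ≤ 1 * T ^ (1 / 2 : ℝ) * (1 + Real.log T) ^ (0 : ℕ) := by
  intro T hT
  have := ab_sqrt_div_pi T hT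
  rw [show 2 * T / (2 * π) = T / π by field_simp]
  exact this

/-- `√(√(T/π)) ≤ T^{1/4}`. [folklore] -/
theorem ab_sqrt_sqrt_div_pi :
    ∀ T : ℝ, 1 ≤ T → 0 ≤ Real.sqrt (Real.sqrt (T / π)) ∧
      Real.sqrt (Real.sqrt (T / π)) ≤ 1 * T ^ (1 / 4 : ℝ) * (1 + Real.log T) ^ (0 : ℕ) := by
  intro T hT
  refine ⟨Real.sqrt_nonneg _, ?_⟩
  simp only [one_mul, pow_zero, mul_one]
  have h := (ab_sqrt_div_pi T hT).2
  simp only [one_mul, pow_zero, mul_one] at h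
  calc Real.sqrt (Real.sqrt (T / π)) ≤ Real.sqrt (T ^ (1 / 2 : ℝ)) := Real.sqrt_le_sqrt h
    _ = T ^ (1 / 4 : ℝ) := by
        rw [Real.sqrt_eq_rpow, ← Real.rpow_mul (by linarith)]; norm_num

/-- `J = ⌊T^κ⌋ + 1 ≤ 2 T^κ`. [folklore] -/
theorem ab_J {κ : ℝ} (hκ : 0 ≤ κ) :
    ∀ T : ℝ, 1 ≤ T → 0 ≤ ((⌊T ^ κ⌋₊ + 1 : ℕ) : ℝ) ∧ ((⌊T ^ κ⌋₊ + 1 : ℕ) : ℝ) ≤ 2 * T ^ κ * (1 + Real.log T) ^ (0 : ℕ) := by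
  intro T hT
  refine ⟨Nat.cast_nonneg _, ?_⟩
  have h1 : ((⌊T ^ κ⌋₊ : ℕ) : ℝ) ≤ T ^ κ := Nat.floor_le (Real.rpow_nonneg (by linarith) κ)
  have h2 : 1 ≤ T ^ κ := Real.one_le_rpow hT hκ
  push_cast
  simp only [pow_zero, mul_one]
  linarith

/-- `T/J ≤ T^{1-κ}` and friends: `1/J ≤ T^{-κ}`. [folklore] -/
theorem one_div_J_le {κ T : ℝ} (hT : 1 ≤ T) :
    1 / ((⌊T ^ κ⌋₊ + 1 : ℕ) : ℝ) ≤ T ^ (-κ) := by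
  have hT0 : 0 < T := by linarith
  have hJ : T ^ κ < ((⌊T ^ κ⌋₊ + 1 : ℕ) : ℝ) := by push_cast; exact Nat.lt_floor_add_one _
  have hpos : 0 < T ^ κ := Real.rpow_pos_of_pos hT0 κ
  rw [Real.rpow_neg hT0.le, ← one_div]
  exact one_div_le_one_div_of_le hpos hJ.le

/-- `(T/J)/T ≤ T^{-κ}`. [folklore] -/
theorem ab_T_div_J_div_T {κ : ℝ} :
    ∀ T : ℝ, 1 ≤ T → 0 ≤ T / ((⌊T ^ κ⌋₊ + 1 : ℕ) : ℝ) / T ∧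
      T / ((⌊T ^ κ⌋₊ + 1 : ℕ) : ℝ) / T ≤ 1 * T ^ (-κ) * (1 + Real.log T) ^ (0 : ℕ) := by
  intro T hT
  have hT0 : 0 < T := by linarith
  have hJ0 : (0 : ℝ) < ((⌊T ^ κ⌋₊ + 1 : ℕ) : ℝ) := by positivity
  refine ⟨by positivity, ?_⟩
  rw [show T / ((⌊T ^ κ⌋₊ + 1 : ℕ) : ℝ) / T = 1 / ((⌊T ^ κ⌋₊ + 1 : ℕ) : ℝ) by field_simp]
  simpa using one_div_J_le (κ := κ) hT

/-- `T/J ≤ T^{1-κ}`. [folklore] -/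
theorem ab_T_div_J {κ : ℝ} :
    ∀ T : ℝ, 1 ≤ T → 0 ≤ T / ((⌊T ^ κ⌋₊ + 1 : ℕ) : ℝ) ∧
      T / ((⌊T ^ κ⌋₊ + 1 : ℕ) : ℝ) ≤ 1 * T ^ (1 - κ) * (1 + Real.log T) ^ (0 : ℕ) := by
  intro T hT
  have hT0 : 0 < T := by linarith
  refine ⟨by positivity, ?_⟩
  simp only [one_mul, pow_zero, mul_one]
  rw [div_eq_mul_one_div, Real.rpow_sub hT0, Real.rpow_one, div_eq_mul_one_div T]
  refine mul_le_mul_of_nonneg_left ?_ hT0.le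
  rw [one_div (T ^ κ), ← Real.rpow_neg hT0.le]
  exact one_div_J_le hT

/-- `(T/J)/√(2πT) ≤ T^{1/2-κ}`. [folklore] -/
theorem ab_T_div_J_div_sqrt {κ : ℝ} :
    ∀ T : ℝ, 1 ≤ T → 0 ≤ T / ((⌊T ^ κ⌋₊ + 1 : ℕ) : ℝ) / Real.sqrt (2 * π * T) ∧
      T / ((⌊T ^ κ⌋₊ + 1 : ℕ) : ℝ) / Real.sqrt (2 * π * T) ≤ 1 * T ^ (1 / 2 - κ) * (1 + Real.log T) ^ (0 : ℕ) := by
  intro T hT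
  have hT0 : 0 < T := by linarith
  have hπ := Real.pi_pos
  refine ⟨by positivity, ?_⟩
  simp only [one_mul, pow_zero, mul_one]
  have h1 := (ab_T_div_J (κ := κ) T hT).2
  simp only [one_mul, pow_zero, mul_one] at h1
  have hs : Real.sqrt T ≤ Real.sqrt (2 * π * T) := Real.sqrt_le_sqrt (by nlinarith [Real.pi_gt_three])
  have hsT : 0 < Real.sqrt T := Real.sqrt_pos.2 hT0
  calc T / ((⌊T ^ κ⌋₊ + 1 : ℕ) : ℝ) / Real.sqrt (2 * π * T) ≤ T ^ (1 - κ) / Real.sqrt T :=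
        div_le_div₀ (Real.rpow_nonneg hT0.le _) h1 hsT hs
    _ = T ^ (1 / 2 - κ) := by
        rw [Real.sqrt_eq_rpow, ← Real.rpow_sub hT0]; ring_nf

/-- `1 + 1/T^{-1/4} ≤ 2T^{1/4}`. [folklore] -/
theorem ab_one_add_inv_rpow :
    ∀ T : ℝ, 1 ≤ T → 0 ≤ 1 + 1 / T ^ (-(1 / 4 : ℝ)) ∧
      1 + 1 / T ^ (-(1 / 4 : ℝ)) ≤ 2 * T ^ (1 / 4 : ℝ) * (1 + Real.log T) ^ (0 : ℕ) := by
  intro T hT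
  have hT0 : 0 < T := by linarith
  have e : 1 / T ^ (-(1 / 4 : ℝ)) = T ^ (1 / 4 : ℝ) := by
    rw [Real.rpow_neg hT0.le, one_div, inv_inv]
  rw [e]
  have h1 : 1 ≤ T ^ (1 / 4 : ℝ) := Real.one_le_rpow hT (by norm_num)
  refine ⟨by positivity, ?_⟩
  simp only [pow_zero, mul_one]; linarith

/-- `5T/2 + 20 ≤ (45/2) T`. [folklore] -/
theorem ab_affine :
    ∀ T : ℝ, 1 ≤ T → 0 ≤ 5 * (T / 2) + 20 ∧ 5 * (T / 2) + 20 ≤ (45 / 2) * T ^ (1 : ℝ) * (1 + Real.log T) ^ (0 : ℕ) := by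
  intro T hT; refine ⟨by positivity, ?_⟩; simp; linarith

/-- `log T ≤ 1 + log T`. [folklore] -/
theorem ab_logT : ∀ T : ℝ, 1 ≤ T → 0 ≤ Real.log T ∧ Real.log T ≤ 1 * T ^ (0 : ℝ) * (1 + Real.log T) ^ (1 : ℕ) := by
  intro T hT
  have := Real.log_nonneg hT
  refine ⟨this, ?_⟩; simp

/-! ### Helpers with explicit targets -/

/-- Atom-bound calculus helper (`0 ≤ f ≤ c·T^a·(1+log T)^m` bookkeeping). [folklore] -/
theorem abK {c a : ℝ} {m : ℕ} (hc : 0 ≤ c) (ha : 0 ≤ a) :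
    ∀ T : ℝ, 1 ≤ T → 0 ≤ c ∧ c ≤ c * T ^ a * (1 + Real.log T) ^ m :=
  ab_mono (ab_const hc) le_rfl ha (Nat.zero_le m)

/-- Product of atom bounds with prescribed target exponent/degree. [folklore] -/
theorem abM {f g : ℝ → ℝ} {c a c' a' a'' : ℝ} {m m' m'' : ℕ}
    (hf : ∀ T : ℝ, 1 ≤ T → 0 ≤ f T ∧ f T ≤ c * T ^ a * (1 + Real.log T) ^ m)
    (hg : ∀ T : ℝ, 1 ≤ T → 0 ≤ g T ∧ g T ≤ c' * T ^ a' * (1 + Real.log T) ^ m')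
    (ha : a + a' ≤ a'') (hm : m + m' ≤ m'') :
    ∀ T : ℝ, 1 ≤ T → 0 ≤ f T * g T ∧ f T * g T ≤ (c * c') * T ^ a'' * (1 + Real.log T) ^ m'' :=
  ab_mono (ab_mul hf hg) le_rfl ha hm

/-- Sum of atom bounds with prescribed target exponent/degree. [folklore] -/
theorem abA {f g : ℝ → ℝ} {c a c' a' a'' : ℝ} {m m' m'' : ℕ}
    (hf : ∀ T : ℝ, 1 ≤ T → 0 ≤ f T ∧ f T ≤ c * T ^ a * (1 + Real.log T) ^ m)
    (hg : ∀ T : ℝ, 1 ≤ T → 0 ≤ g T ∧ g T ≤ c' * T ^ a' * (1 + Real.log T) ^ m')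
    (ha : a ≤ a'') (ha' : a' ≤ a'') (hm : m ≤ m'') (hm' : m' ≤ m'') :
    ∀ T : ℝ, 1 ≤ T → 0 ≤ f T + g T ∧ f T + g T ≤ (c + c') * T ^ a'' * (1 + Real.log T) ^ m'' := by
  have hc : 0 ≤ c := by
    have := hf 1 le_rfl; simp at this; exact this.1.trans this.2
  have hc' : 0 ≤ c' := by
    have := hg 1 le_rfl; simp at this; exact this.1.trans this.2
  exact ab_add (ab_mono hf le_rfl ha hm) (ab_mono hg le_rfl ha' hm')


/-! ### The total error is `O(T^{1-κ/2} log⁵ T)` -/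

set_option maxHeartbeats 1600000 in
/-- **The total error at height `T` with `N = ⌊T^θ⌋`, `J = ⌊T^κ⌋ + 1`, `η = T^{-1/4}`,
`B = B₀ T^{θδ}` (`κ = (½−θ)/2`, `θδ = κ/4`) is `≤ K T^{1−κ/2}(1 + log T)^m` for `T ≥ 1`.** [folklore] -/
theorem totalErr_bound {θ κ δ B₀ : ℝ} (C₁ : ℝ) (hθ : 0 < θ) (hθ2 : θ < 1 / 2) (hκ : κ = (1 / 2 - θ) / 2)
    (hθδ : θ * δ = κ / 4) (hB₀ : 0 ≤ B₀) :
    ∃ K : ℝ, ∃ m : ℕ, ∀ T : ℝ, 1 ≤ T →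
      2 * diagErrBound T ⌊T ^ θ⌋₊ (B₀ * T ^ (θ * δ)) +
        2 * (((⌊T ^ κ⌋₊ + 1 : ℕ) : ℝ) * blockErr T ⌊T ^ θ⌋₊ (B₀ * T ^ (θ * δ)) (⌊T ^ κ⌋₊ + 1)) +
        (4 * T ^ (-(1 / 4 : ℝ)) * (diagMainBound T ⌊T ^ θ⌋₊ (B₀ * T ^ (θ * δ)) + diagErrBound T ⌊T ^ θ⌋₊ (B₀ * T ^ (θ * δ))) +
          (1 + 1 / T ^ (-(1 / 4 : ℝ))) * C₁ ^ 2 * T ^ (-(1 / 2 : ℝ)) * amsBound T ⌊T ^ θ⌋₊ (B₀ * T ^ (θ * δ))) ≤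
      K * T ^ (1 - κ / 2) * (1 + Real.log T) ^ m := by
  have hκ0 : 0 < κ := by rw [hκ]; linarith
  have hκ4 : κ ≤ 1 / 4 := by rw [hκ]; linarith
  have hθδ0 : 0 ≤ θ * δ := by rw [hθδ]; linarith
  have hπ := Real.pi_pos
  have hlog7 : Real.log 7 ≤ 2 := by
    have h1 : Real.exp 1 > 2.7 := by have := Real.exp_one_gt_d9; linarith
    have h2 : (7 : ℝ) ≤ Real.exp 2 := by
      have : Real.exp 2 = Real.exp 1 * Real.exp 1 := by rw [← Real.exp_add]; norm_num
      nlinarith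
    calc Real.log 7 ≤ Real.log (Real.exp 2) := Real.log_le_log (by linarith) h2
      _ = 2 := Real.log_exp 2
  -- atoms
  have aN := ab_natFloor_rpow θ
  have aB : ∀ T : ℝ, 1 ≤ T → 0 ≤ B₀ * T ^ (θ * δ) ∧ B₀ * T ^ (θ * δ) ≤ B₀ * T ^ (θ * δ) * (1 + Real.log T) ^ (0 : ℕ) :=
    fun T hT => ⟨by positivity, by simp⟩
  have aB2 := ab_mono (ab_pow aB 2) le_rfl (show ((2 : ℕ) : ℝ) * (θ * δ) ≤ κ / 2 by push_cast; linarith)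
    (show 2 * 0 ≤ 0 by norm_num)
  have alN := ab_log_natFloor_rpow θ
  have hc1 : Real.log 1 + max θ 1 ≤ 1 := by rw [Real.log_one, max_eq_right (by linarith)]; linarith
  have aLN := abA (abK (c := 1) zero_le_one le_rfl) (ab_mono alN hc1 le_rfl le_rfl)
    (le_refl (0:ℝ)) le_rfl (Nat.zero_le 1) le_rfl      -- `1 + log N ≤ 2 L`
  have aX := ab_natFloor_sqrt
  have aS := ab_sqrt_div_pi
  have aST := ab_sqrt
  have aSS := ab_sqrt_sqrt_div_pi
  have aS2 := ab_sqrt_two_mul_div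
  have aT := ab_id
  have aJ := ab_J hκ0.le
  have aTJT := ab_T_div_J_div_T (κ := κ)
  have aTJ := ab_T_div_J (κ := κ)
  have aTJS := ab_T_div_J_div_sqrt (κ := κ)
  have aη := ab_rpow (-(1 / 4 : ℝ))
  have a1η := ab_one_add_inv_rpow
  have aTm := ab_rpow (-(1 / 2 : ℝ))
  have aC := abK (c := C₁ ^ 2) (a := 0) (m := 0) (sq_nonneg _) le_rfl
  have alT := ab_logT
  -- `G = 2TN + √(T/π)N + √(T/π) + 3 ≤ k T^{1+θ}`
  have g1 := abM (abM (abK (c := 2) (a := 0) (m := 0) (by linarith) le_rfl) aT (a'' := 1) (m'' := 0)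
    (by linarith) (by linarith)) aN (a'' := 1 + θ) (m'' := 0) (by linarith) (by linarith)
  have g2 := abM aS aN (a'' := 1 + θ) (m'' := 0) (by linarith) (by linarith)
  have g3 := ab_mono aS le_rfl (show (1 / 2 : ℝ) ≤ 1 + θ by linarith) (le_refl 0)
  have g4 := abK (c := 3) (a := 1 + θ) (m := 0) (by linarith) (by linarith)
  have aG := abA (abA (abA g1 g2 le_rfl le_rfl le_rfl le_rfl) g3 le_rfl le_rfl le_rfl le_rfl) g4
    (a'' := 1 + θ) (m'' := 0) le_rfl le_rfl le_rfl le_rfl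
  have alG := ab_log_of_le (p := 1 + θ) (k := 2 + 1 + 1 + 3) (by linarith)
    (g := fun T => 2 * T * ((⌊T ^ θ⌋₊ : ℕ) : ℝ) + Real.sqrt (T / π) * ((⌊T ^ θ⌋₊ : ℕ) : ℝ) + Real.sqrt (T / π) + 3)
    (fun T hT => by
      obtain ⟨h0, h1⟩ := aG T hT
      simp only [pow_zero, mul_one] at h1
      have hG1 : (1 : ℝ) ≤ 2 * T * ((⌊T ^ θ⌋₊ : ℕ) : ℝ) + Real.sqrt (T / π) * ((⌊T ^ θ⌋₊ : ℕ) : ℝ) +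
          Real.sqrt (T / π) + 3 := by
        have := (g1 T hT).1; have := (g2 T hT).1; have := (aS T hT).1; linarith
      exact ⟨Real.log_nonneg hG1, h0, h1⟩)
  -- pieces of `blockErr`
  have t133 := abA (abA (abK (c := 13) (a := 0) (m := 1) (by linarith) le_rfl)
    (abM (abK (c := 3) (a := 0) (m := 0) (by linarith) le_rfl) alG (a'' := 0) (m'' := 1) (by linarith) (by linarith))
    le_rfl le_rfl le_rfl le_rfl)
    (abM (abK (c := 3) (a := 0) (m := 0) (by linarith) le_rfl) alG (a'' := 0) (m'' := 1) (by linarith) (by linarith))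
    (a'' := 0) (m'' := 1) le_rfl le_rfl le_rfl le_rfl
  have t1G := abA (abK (c := 1) (a := 0) (m := 1) (by linarith) le_rfl) alG (a'' := 0) (m'' := 1)
    le_rfl le_rfl le_rfl le_rfl
  have asπ := abK (c := Real.sqrt π) (a := 0) (m := 0) (Real.sqrt_nonneg _) le_rfl
  have aπ := abK (c := π) (a := 0) (m := 0) hπ.le le_rfl
  have in1 := abA
    (abM (abM (abM (abK (c := 8) (a := 0) (m := 0) (by linarith) le_rfl) t133 (a'' := 0) (m'' := 1)
      (by linarith) (by linarith)) t1G (a'' := 0) (m'' := 2) (by linarith) (by linarith)) aS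
      (a'' := 1 / 2) (m'' := 2) (by linarith) (by linarith))
    (abM (abM (abK (c := 24) (a := 0) (m := 0) (by linarith) le_rfl) asπ (a'' := 0) (m'' := 0)
      (by linarith) (by linarith)) aS (a'' := 1 / 2) (m'' := 0) (by linarith) (by linarith))
    (a'' := 1 / 2) (m'' := 2) le_rfl le_rfl le_rfl (by linarith)
  have aB2N := abM aB2 aN (a'' := κ / 2 + θ) (m'' := 0) le_rfl (by linarith)
  have aB2NL := abM aB2N aLN (a'' := κ / 2 + θ) (m'' := 1) (by linarith) (by linarith)
  have Ea := abM aB2NL in1 (a'' := κ / 2 + θ + 1 / 2) (m'' := 3) le_rfl (by linarith)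
  have in2 := abA
    (abM (abM (abK (c := 8) (a := 0) (m := 0) (by linarith) le_rfl) t133 (a'' := 0) (m'' := 1)
      (by linarith) (by linarith)) aS (a'' := 1 / 2) (m'' := 1) (by linarith) (by linarith))
    (abM (abK (c := 24) (a := 0) (m := 0) (by linarith) le_rfl) aST (a'' := 1 / 2) (m'' := 0)
      (by linarith) (by linarith))
    (a'' := 1 / 2) (m'' := 1) le_rfl le_rfl le_rfl (by linarith)
  have Eb := abM (abM aB2NL t1G (a'' := κ / 2 + θ) (m'' := 2) (by linarith) (by linarith)) in2
    (a'' := κ / 2 + θ + 1 / 2) (m'' := 3) le_rfl (by linarith)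
  have in3 := abM aSS
    (abA (abM (abK (c := 2) (a := 0) (m := 0) (by linarith) le_rfl) asπ (a'' := 0) (m'' := 0) (by linarith) (by linarith))
      (abM (abK (c := 2) (a := 0) (m := 0) (by linarith) le_rfl)
        (abA (abA (abK (c := 2) (a := 0) (m := 1) (by linarith) le_rfl) alG (a'' := 0) (m'' := 1)
          le_rfl le_rfl le_rfl le_rfl) alG (a'' := 0) (m'' := 1) le_rfl le_rfl le_rfl le_rfl)
        (a'' := 0) (m'' := 1) (by linarith) (by linarith))
      (a'' := 0) (m'' := 1) le_rfl le_rfl (by linarith) le_rfl)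
    (a'' := 1 / 4) (m'' := 1) (by linarith) (by linarith)
  have Ec := abM (abM (abM (abM (abK (c := 64) (a := 0) (m := 0) (by linarith) le_rfl) aB2
    (a'' := κ / 2) (m'' := 0) (by linarith) (by linarith)) aN (a'' := κ / 2 + θ) (m'' := 0) le_rfl (by linarith))
    aSS (a'' := κ / 2 + θ + 1 / 4) (m'' := 0) le_rfl (by linarith)) in3
    (a'' := κ / 2 + θ + 1 / 2) (m'' := 3) (by linarith) (by linarith)
  have W1 := abM (abM (abM (abK (c := 4400) (a := 0) (m := 0) (by linarith) le_rfl) aB2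
    (a'' := κ / 2) (m'' := 0) (by linarith) (by linarith)) aN (a'' := κ / 2 + θ) (m'' := 0) le_rfl (by linarith))
    aS (a'' := κ / 2 + θ + 1 / 2) (m'' := 3) le_rfl (by linarith)
  have W := abA W1 (abM (abK (c := 32) (a := 0) (m := 0) (by linarith) le_rfl)
    (abA (abA (abA Ea Eb le_rfl le_rfl le_rfl le_rfl) Ec le_rfl le_rfl le_rfl le_rfl) Ea le_rfl le_rfl le_rfl le_rfl)
    (a'' := κ / 2 + θ + 1 / 2) (m'' := 3) (by linarith) (by linarith))
    (a'' := κ / 2 + θ + 1 / 2) (m'' := 3) le_rfl le_rfl le_rfl le_rfl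
  -- the main-sum part
  have aLN3 := ab_pow aLN 3
  have m1 := abM (abM (abM (abK (c := 2) (a := 0) (m := 0) (by linarith) le_rfl) aTJT (a'' := -κ) (m'' := 0)
    (by linarith) (by linarith)) aTJ (a'' := 1 - 2 * κ) (m'' := 0) (by linarith) (by linarith)) aLN3
    (a'' := 1 / 2 + θ) (m'' := 3) (by rw [hκ]; push_cast; linarith) (by linarith)
  have m2 := abM (abM (abM (abM (abK (c := 2) (a := 0) (m := 0) (by linarith) le_rfl) aπ (a'' := 0) (m'' := 0)
    (by linarith) (by linarith)) aN (a'' := θ) (m'' := 0) (by linarith) (by linarith)) aLN (a'' := θ) (m'' := 1)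
    (by linarith) (by linarith))
    (abA (abA (abM (abK (c := 7) (a := 0) (m := 0) (by linarith) le_rfl) aTJS (a'' := 1 / 2) (m'' := 0)
      (by linarith) (by linarith)) (abM (abK (c := 2) (a := 0) (m := 0) (by linarith) le_rfl) aS2
      (a'' := 1 / 2) (m'' := 0) (by linarith) (by linarith)) le_rfl le_rfl le_rfl le_rfl)
      (abK (c := 2) (a := 1 / 2) (m := 0) (by linarith) (by linarith)) (a'' := 1 / 2) (m'' := 0)
      le_rfl le_rfl le_rfl le_rfl)
    (a'' := 1 / 2 + θ) (m'' := 3) (by linarith) (by linarith)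
  have aN2 := ab_pow aN 2
  have m3 := abM (abM (abM (abK (c := 2) (a := 0) (m := 0) (by linarith) le_rfl) aπ (a'' := 0) (m'' := 0)
    (by linarith) (by linarith)) aLN (a'' := 0) (m'' := 1) (by linarith) (by linarith))
    (abA (abM (abM aS aN (a'' := 1 / 2 + θ) (m'' := 0) le_rfl (by linarith)) aLN (a'' := 1 / 2 + θ) (m'' := 1)
      (by linarith) (by linarith)) aN2 (a'' := 1 / 2 + θ) (m'' := 1) le_rfl (by push_cast; linarith)
      le_rfl (by linarith))
    (a'' := 1 / 2 + θ) (m'' := 3) (by linarith) (by linarith)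
  have M := abM aB2 (abA (abA m1 m2 le_rfl le_rfl le_rfl le_rfl) m3 le_rfl le_rfl le_rfl le_rfl)
    (a'' := κ / 2 + θ + 1 / 2) (m'' := 3) (by linarith) (by linarith)
  have hblock := abA W M (a'' := κ / 2 + θ + 1 / 2) (m'' := 3) le_rfl le_rfl le_rfl le_rfl
  have JB := abM aJ hblock (a'' := 1 - κ / 2) (m'' := 3) (by rw [hκ]; linarith) (by linarith)
  -- `diagErrBound`
  have aN1 := abA aN (abK (c := 1) (a := θ) (m := 0) (by linarith) hθ.le) (a'' := θ) (m'' := 0)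
    le_rfl le_rfl le_rfl le_rfl
  have d1 := abM (abM (abM (abK (c := 26) (a := 0) (m := 0) (by linarith) le_rfl) aπ (a'' := 0) (m'' := 0)
    (by linarith) (by linarith)) aB2 (a'' := κ / 2) (m'' := 0) (by linarith) (by linarith))
    (abM (abM aN aN1 (a'' := 2 * θ) (m'' := 0) (by linarith) (by linarith)) aLN (a'' := 2 * θ) (m'' := 1)
      (by linarith) (by linarith))
    (a'' := κ / 2 + θ + 1 / 2) (m'' := 5) (by linarith) (by linarith)
  have aNX := ab_congr (g := fun T => ((⌊T ^ θ⌋₊ * ⌊Real.sqrt (2 * T / (2 * π))⌋₊ : ℕ) : ℝ))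
    (abM aN aX (a'' := θ + 1 / 2) (m'' := 0) le_rfl (by linarith)) (fun T _ => by push_cast; ring)
  have alNX := ab_log_of_le (p := θ + 1 / 2) (k := 1 * 1) (by linarith)
    (g := fun T => ((⌊T ^ θ⌋₊ * ⌊Real.sqrt (2 * T / (2 * π))⌋₊ : ℕ) : ℝ))
    (fun T hT => ⟨Real.log_natCast_nonneg _, Nat.cast_nonneg _, by simpa [pow_zero] using (aNX T hT).2⟩)
  have aLNX := abA (abK (c := 1) (a := 0) (m := 1) (by linarith) le_rfl) alNX (a'' := 0) (m'' := 1)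
    le_rfl le_rfl le_rfl le_rfl
  have alX := ab_log_of_le (p := 1 / 2) (k := 1) le_rfl
    (g := fun T => ((⌊Real.sqrt (2 * T / (2 * π))⌋₊ : ℕ) : ℝ))
    (fun T hT => ⟨Real.log_natCast_nonneg _, Nat.cast_nonneg _, by simpa [pow_zero] using (aX T hT).2⟩)
  have aLX := abA (abK (c := 1) (a := 0) (m := 1) (by linarith) le_rfl) alX (a'' := 0) (m'' := 1)
    le_rfl le_rfl le_rfl le_rfl
  have d2 := abM
    (abM (abK (c := 2) (a := 0) (m := 0) (by linarith) le_rfl)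
      (abM (abM (abK (c := 2) (a := 0) (m := 0) (by linarith) le_rfl) aNX (a'' := θ + 1 / 2) (m'' := 0)
        (by linarith) (by linarith)) aLNX (a'' := θ + 1 / 2) (m'' := 1) (by linarith) (by linarith))
      (a'' := θ + 1 / 2) (m'' := 1) (by linarith) (by linarith))
    (abM aB2 (abM aLX aLN3 (a'' := 0) (m'' := 4) (by linarith) (by linarith)) (a'' := κ / 2) (m'' := 4)
      (by linarith) (by linarith))
    (a'' := κ / 2 + θ + 1 / 2) (m'' := 5) (by linarith) (by linarith)
  have dEB := abA d1 d2 (a'' := κ / 2 + θ + 1 / 2) (m'' := 5) le_rfl le_rfl le_rfl le_rfl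
  -- `diagMainBound`, `amsBound`
  have dMB := abM (abM aB2 aLN3 (a'' := κ / 2) (m'' := 3) (by linarith) (by linarith))
    (abM aT (abA (abA alT (abM (abK (c := 2) (a := 0) (m := 0) (by linarith) le_rfl) alN (a'' := 0) (m'' := 1)
      (by linarith) (by linarith)) le_rfl le_rfl le_rfl le_rfl) (abK (c := 3) (a := 0) (m := 1) (by linarith) le_rfl)
      (a'' := 0) (m'' := 1) le_rfl le_rfl le_rfl le_rfl) (a'' := 1) (m'' := 1) (by linarith) (by linarith))
    (a'' := κ / 2 + 1) (m'' := 5) (by linarith) (by linarith)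
  have ams := abM aB2 (abA (abM ab_affine aLN (a'' := 1) (m'' := 1) (by linarith) (by linarith))
    (abM (abK (c := 65) (a := 0) (m := 0) (by linarith) le_rfl) aN (a'' := 1) (m'' := 1) (by linarith) (by linarith))
    le_rfl le_rfl le_rfl le_rfl) (a'' := κ / 2 + 1) (m'' := 1) (by linarith) (by linarith)
  -- the total
  have P3 := abA
    (abM (abM (abK (c := 4) (a := 0) (m := 0) (by linarith) le_rfl) aη (a'' := -(1 / 4)) (m'' := 0)
      (by linarith) (by linarith))
      (abA dMB dEB (a'' := κ / 2 + 1) (m'' := 5) le_rfl (by linarith) le_rfl le_rfl)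
      (a'' := 1 - κ / 2) (m'' := 5) (by linarith) (by linarith))
    (abM (abM (abM a1η aC (a'' := 1 / 4) (m'' := 0) (by linarith) (by linarith)) aTm (a'' := -(1 / 4))
      (m'' := 0) (by linarith) (by linarith)) ams (a'' := 1 - κ / 2) (m'' := 5) (by linarith) (by linarith))
    (a'' := 1 - κ / 2) (m'' := 5) le_rfl le_rfl le_rfl le_rfl
  have E := abA (abA (abM (abK (c := 2) (a := 0) (m := 0) (by linarith) le_rfl) dEB (a'' := 1 - κ / 2) (m'' := 5)
      (by rw [hκ]; linarith) (by linarith))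
    (abM (abK (c := 2) (a := 0) (m := 0) (by linarith) le_rfl) JB (a'' := 1 - κ / 2) (m'' := 5)
      (by linarith) (by linarith)) le_rfl le_rfl le_rfl le_rfl) P3
    (a'' := 1 - κ / 2) (m'' := 5) le_rfl le_rfl le_rfl le_rfl
  exact ⟨_, 5, fun T hT => by
    simpa only [blockErr, diagErrBound, diagMainBound, amsBound] using (E T hT).2⟩


/-! ### The theorem -/

/-- Eventually `2⌊T^θ⌋ ≤ √(T/2π)` for `θ < ½`. [folklore] -/
theorem eventually_two_natFloor_le_sqrt {θ : ℝ} (hθ2 : θ < 1 / 2) :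
    ∀ᶠ T : ℝ in atTop, 2 * ((⌊T ^ θ⌋₊ : ℕ) : ℝ) ≤ Real.sqrt (T / (2 * π)) := by
  have hπ := Real.pi_pos
  have hc : 0 < 1 / (2 * Real.sqrt (2 * π)) := by positivity
  have ht := tendsto_rpow_neg_atTop (y := 1 / 2 - θ) (by linarith)
  have hev : ∀ᶠ T : ℝ in atTop, T ^ (-(1 / 2 - θ)) < 1 / (2 * Real.sqrt (2 * π)) :=
    (tendsto_order.1 ht).2 _ hc
  filter_upwards [hev, eventually_ge_atTop (1 : ℝ)] with T h1 hT
  have hT0 : 0 < T := by linarith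
  have hfloor : ((⌊T ^ θ⌋₊ : ℕ) : ℝ) ≤ T ^ θ := Nat.floor_le (Real.rpow_nonneg hT0.le θ)
  have hs : 0 < Real.sqrt (2 * π) := Real.sqrt_pos.2 (by positivity)
  -- `T^θ = T^{1/2} · T^{-(1/2-θ)} ≤ T^{1/2}/(2√(2π))`
  have e : T ^ θ = T ^ (1 / 2 : ℝ) * T ^ (-(1 / 2 - θ)) := by
    rw [← Real.rpow_add hT0]; ring_nf
  have h2 : T ^ θ ≤ T ^ (1 / 2 : ℝ) * (1 / (2 * Real.sqrt (2 * π))) := by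
    rw [e]; exact mul_le_mul_of_nonneg_left h1.le (Real.rpow_nonneg hT0.le _)
  have e2 : Real.sqrt (T / (2 * π)) = T ^ (1 / 2 : ℝ) / Real.sqrt (2 * π) := by
    rw [Real.sqrt_div' T (by positivity), Real.sqrt_eq_rpow]
  rw [e2]
  have : 2 * (T ^ (1 / 2 : ℝ) * (1 / (2 * Real.sqrt (2 * π)))) = T ^ (1 / 2 : ℝ) / Real.sqrt (2 * π) := by
    field_simp
  linarith

/-- `‖ζ(½+it) M(½+it)‖² = |ζ(½+it)|² |A(t)|²`. [folklore] -/
theorem norm_sq_zeta_mul_mollifier (a : ℕ → ℂ) (N : ℕ) (t : ℝ) :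
    ‖riemannZeta (1 / 2 + t * I) * dirichletMollifier a N (1 / 2 + t * I)‖ ^ 2 =
      ‖riemannZeta (1 / 2 + t * I)‖ ^ 2 * ‖mollPoly a N t‖ ^ 2 := by
  rw [dirichletMollifier_half_eq, norm_mul, mul_pow]

set_option maxHeartbeats 800000 in
/-- **Balasubramanian–Conrey–Heath-Brown (1985), Theorem 1, `θ < ½`: the named fact
`BalasubramanianConreyHeathBrown1985_meanSquare` holds.** For `0 < θ < ½`, mollifier coefficients
`|a(n)| ≤ C(δ) n^δ` for all `δ > 0`, `N = ⌊T^θ⌋`: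
`T⁻¹ ∫_T^{2T} |ζ(½+it) M(½+it)|² dt = 𝒬_T(a) + o(1)` uniformly in the class.
[cite: BalasubramanianConreyHeathBrown1985, Theorem 1], [cite: BettinChandeeRadziwill2017, (1.2)] -/
theorem BalasubramanianConreyHeathBrown1985_meanSquare_holds : BalasubramanianConreyHeathBrown1985_meanSquare := by
  intro θ hθ hθ2 C ε hε
  have hπ := Real.pi_pos
  obtain ⟨C₁, t₁, hC₁, ht₁, herr⟩ := norm_actErr_le
  set κ : ℝ := (1 / 2 - θ) / 2 with hκ
  have hκ0 : 0 < κ := by rw [hκ]; linarith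
  set δ : ℝ := κ / (4 * θ) with hδ
  have hδ0 : 0 < δ := by positivity
  have hθδ : θ * δ = κ / 4 := by rw [hδ]; field_simp
  set B₀ : ℝ := |C δ| with hB₀
  obtain ⟨K, m, hK⟩ := totalErr_bound C₁ hθ hθ2 hκ hθδ (abs_nonneg (C δ))
  -- the envelope is eventually `≤ ε T`
  have hlo := isLittleO_rpow_mul_log_pow (e := 1 - κ / 2) (by linarith) m K
  have hev1 : ∀ᶠ T : ℝ in atTop, ‖K * T ^ (1 - κ / 2) * (1 + Real.log T) ^ m‖ ≤ ε * ‖T‖ := hlo.def hε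
  have hev2 := eventually_two_natFloor_le_sqrt hθ2
  have hev3 := eventually_ge_atTop (max t₁ (max (2 * π) 1))
  obtain ⟨T₀, hT₀⟩ := Filter.eventually_atTop.1 (hev1.and (hev2.and hev3))
  refine ⟨T₀, fun T hT a ha => ?_⟩
  obtain ⟨h1, h2, h3⟩ := hT₀ T hT
  have ht₁T : t₁ ≤ T := le_trans (le_max_left _ _) h3
  have hT2π : 2 * π ≤ T := le_trans ((le_max_left _ _).trans (le_max_right _ _)) h3
  have hT1 : 1 ≤ T := le_trans ((le_max_right _ _).trans (le_max_right _ _)) h3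
  have hT0 : 0 < T := by linarith
  -- parameters at height `T`
  set N : ℕ := ⌊T ^ θ⌋₊ with hN
  set J : ℕ := ⌊T ^ κ⌋₊ + 1 with hJ
  set η : ℝ := T ^ (-(1 / 4 : ℝ)) with hη
  set B : ℝ := B₀ * T ^ (θ * δ) with hB
  have hJ0 : 0 < J := Nat.succ_pos _
  have hη0 : 0 < η := Real.rpow_pos_of_pos hT0 _
  -- the coefficient bound `|a_h| ≤ B`
  have hBh : ∀ h ∈ Finset.Icc 1 N, ‖a h‖ ≤ B := by
    intro h hh
    have hh1 : 1 ≤ h := (Finset.mem_Icc.1 hh).1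
    have hhN : h ≤ N := (Finset.mem_Icc.1 hh).2
    have hhR : (0 : ℝ) ≤ h := Nat.cast_nonneg h
    have h1' := ha δ hδ0 h hh1
    have hNle : ((N : ℕ) : ℝ) ≤ T ^ θ := Nat.floor_le (Real.rpow_nonneg hT0.le θ)
    have hhT : (h : ℝ) ≤ T ^ θ := le_trans (by exact_mod_cast hhN) hNle
    calc ‖a h‖ ≤ C δ * (h : ℝ) ^ δ := h1'
      _ ≤ |C δ| * (h : ℝ) ^ δ := mul_le_mul_of_nonneg_right (le_abs_self _) (Real.rpow_nonneg hhR δ)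
      _ ≤ |C δ| * (T ^ θ) ^ δ :=
          mul_le_mul_of_nonneg_left (Real.rpow_le_rpow hhR hhT hδ0.le) (abs_nonneg _)
      _ = B := by rw [hB, hB₀, ← Real.rpow_mul hT0.le]
  -- Step A at height `T`
  have hA := abs_meanSquare_sub_quadForm_le a (N := N) (J := J) (B := B) (η := η) herr
    (by linarith) ht₁T hT2π h2 hJ0 hη0 hBh
  -- the envelope
  have hE := hK T hT1
  have hεT : K * T ^ (1 - κ / 2) * (1 + Real.log T) ^ m ≤ ε * T := by
    have := h1
    rw [Real.norm_of_nonneg hT0.le] at this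
    exact le_trans (le_norm_self _) this
  have hmain : |(∫ t in T..(2 * T), ‖riemannZeta (1 / 2 + t * I)‖ ^ 2 * ‖mollPoly a N t‖ ^ 2) -
      T * bchQuadForm T N a| ≤ ε * T := hA.trans (hE.trans hεT)
  -- back to the statement
  have hint : (∫ t in T..(2 * T), ‖riemannZeta (1 / 2 + t * I) * dirichletMollifier a N (1 / 2 + t * I)‖ ^ 2) =
      ∫ t in T..(2 * T), ‖riemannZeta (1 / 2 + t * I)‖ ^ 2 * ‖mollPoly a N t‖ ^ 2 :=
    intervalIntegral.integral_congr fun t _ => norm_sq_zeta_mul_mollifier a N t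
  rw [hint]
  generalize hX : (∫ t in T..(2 * T), ‖riemannZeta (1 / 2 + t * I)‖ ^ 2 * ‖mollPoly a N t‖ ^ 2) = X
  rw [hX] at hmain
  have e : T⁻¹ * X - bchQuadForm T N a = (X - T * bchQuadForm T N a) / T := by
    field_simp
  rw [e, abs_div, abs_of_pos hT0, div_le_iff₀ hT0]
  exact hmain

end Literature.Barriers.RiemannHypothesis
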